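import Summits.RiemannHypothesis.RiemannHypothesis.Theorems.SemilocalDeletionToeplitzBandEdge
import HarnessLib

/-!
# The band-edge DEFICIT: how far below `2·log p/(√p + 1)` a finite window stays

`SemilocalDeletionToeplitzBandEdge.lean` proved that on a window with `m` visible powers of `p` the deletion floor constant can be taken
`F̂_p(m) = 2·log p·(1 + c_m√p)/(p + 2c_m√p + 1)`, `c_m = cos(π/(m+2))`, in place of the all-window `F_p = 2·log p/(√p + 1)`.  Here the
saving is made explicit and window-uniform:

* `allWindow_sub_bandEdge_eq`: `F_p − F̂_p(m) = 2·log p·(1 − c_m)·√p(√p − 1)/((√p + 1)(p + 2c_m√p + 1))` (exact);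
* `allWindow_sub_bandEdge_ge`: `F_p − F̂_p(m) ≥ κ_p·(1 − c_m)`, `κ_p = 2·log p·√p(√p − 1)/(√p + 1)³`; `one_sub_cos_ge`: `1 − c_m ≥ 2/(m+2)²`;
* `bandEdge_sub_bandEdgeComb_le`: `F̂_p(m) − F̌_p(m) ≤ 4π²·log p·(p + √p)/(p(p+1)(m+2)³)` (`F̌` = the comb value of
  `SemilocalDeletionToeplitzBandEdgeCombs`): the sharp floor `μ_m(p) ∈ [F̌_p(m), F̂_p(m)]` is located to `O(m⁻³)`, its deficit is `≍ m⁻²`;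
* `semilocalGroundEnergy_erase_ge_window` (★ window form, no `m`): for EVERY `c ≥ 0`, prime `p ∈ S`, constraint `P`:
  `λ_min(S∖{p}; c; P) ≥ λ_min(S; c; P) − F_p + (log p)³·√p(√p − 1)/((√p + 1)³·(c + log p)²)`;
* `semilocalGroundEnergy_sdiff_ge_window`: deleting a finite set `T` of primes costs at most `Σ_{p∈T} [F_p − (log p)³√p(√p−1)/((√p+1)³(c+log p)²)]`
  — the JOINT lag floor of HOME/cc-s2-1/gen17/ANIMAL-SUPREMUM.md stays below its additive all-window limit `Σ_p F_p` by at least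
  `Σ_p K_p/(c + log p)²` at every finite bandwidth (the `b⁻²` law of §9 there, lower side, as a theorem).

`p = 2`: `κ_2 = 0.0577`, `K_2 = (log 2)³·√2(√2−1)/(√2+1)³ = 0.01386`; at `c = 2, 4, 6` the guaranteed saving is `1.9e−3, 6.3e−4, 3.1e−4`
(sharp deficits `7.8e−3, 1.9e−3, 8.7e−4`; the `m`-form `κ_p(1 − c_m)` gives `5.7e−3, 1.7e−3, 7.9e−4`, the exact `F_p − F̂_p(m)` `6.0e−3, 1.7e−3, 7.9e−4`).
Nothing here bears on RH; these are statements about truncated Weil forms.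
-/

set_option linter.dupNamespace false

noncomputable section

open Complex Filter Set MeasureTheory
open scoped Real Topology ComplexConjugate

namespace Summit.RiemannHypothesis.RiemannHypothesis.Theorems.SemilocalDeletionToeplitzBandEdgeDeficit

open Literature.NumberTheory.LFunctions
open Summit.RiemannHypothesis.RiemannHypothesis.Theorems.SemilocalDeletionToeplitzBandEdge
open Summit.RiemannHypothesis.RiemannHypothesis.Theorems.HandoffSemilocalEnergy

/-! ## §1  The saving `F_p − F̂_p(m)` -/

/-- **Exact saving.** `F_p − F̂_p(m) = 2·log p·(1 − c_m)·√p(√p − 1)/((√p + 1)(p + 2c_m√p + 1))` (`p > 0`, any `c_m` with positive denominator;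
stated for the actual `c_m = cos(π/(m+2))`). -/
theorem allWindow_sub_bandEdge_eq {p : ℕ} (hp : p.Prime) (m : ℕ) :
    2 * Real.log p / (Real.sqrt p + 1) -
        2 * Real.log p * (1 + Real.cos (π / (m + 2)) * Real.sqrt p) / (p + 2 * Real.cos (π / (m + 2)) * Real.sqrt p + 1) =
      2 * Real.log p * (1 - Real.cos (π / (m + 2))) * (Real.sqrt p * (Real.sqrt p - 1)) /
        ((Real.sqrt p + 1) * (p + 2 * Real.cos (π / (m + 2)) * Real.sqrt p + 1)) := by
  have hp0 : (0 : ℝ) < p := by exact_mod_cast hp.pos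
  have hs0 : 0 < Real.sqrt p := Real.sqrt_pos.2 hp0
  have hc0 : 0 ≤ Real.cos (π / (m + 2)) := cos_weight_nonneg m
  set L := Real.log (p : ℝ)
  set c := Real.cos (π / (m + 2))
  set r := Real.sqrt (p : ℝ) with hr
  have hpr : (p : ℝ) = r ^ 2 := (Real.sq_sqrt hp0.le).symm
  have h2c : 0 ≤ 2 * c * r := by positivity
  have hD : (p : ℝ) + 2 * c * r + 1 ≠ 0 := by linarith
  have hr1 : r + 1 ≠ 0 := by positivity
  rw [div_sub_div _ _ hr1 hD, hpr]
  congr 1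
  ring

/-- **The saving is at least `κ_p·(1 − c_m)`**, `κ_p = 2·log p·√p(√p − 1)/(√p + 1)³` (since `p + 2c_m√p + 1 ≤ (√p + 1)²`). -/
theorem allWindow_sub_bandEdge_ge {p : ℕ} (hp : p.Prime) (m : ℕ) :
    2 * Real.log p * (Real.sqrt p * (Real.sqrt p - 1)) / (Real.sqrt p + 1) ^ 3 * (1 - Real.cos (π / (m + 2))) ≤
      2 * Real.log p / (Real.sqrt p + 1) -
        2 * Real.log p * (1 + Real.cos (π / (m + 2)) * Real.sqrt p) / (p + 2 * Real.cos (π / (m + 2)) * Real.sqrt p + 1) := by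
  rw [allWindow_sub_bandEdge_eq hp m]
  have hp0 : (0 : ℝ) < p := by exact_mod_cast hp.pos
  have hp1 : (1 : ℝ) < p := by exact_mod_cast hp.one_lt
  have hs1 : 1 < Real.sqrt p := by rw [show (1 : ℝ) = Real.sqrt 1 by simp]; exact Real.sqrt_lt_sqrt zero_le_one hp1
  have hc0 : 0 ≤ Real.cos (π / (m + 2)) := cos_weight_nonneg m
  have hc1 : Real.cos (π / (m + 2)) ≤ 1 := Real.cos_le_one _
  set L := Real.log (p : ℝ)
  set c := Real.cos (π / (m + 2))
  set r := Real.sqrt (p : ℝ) with hr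
  have hpr : (p : ℝ) = r ^ 2 := (Real.sq_sqrt hp0.le).symm
  have hL : 0 ≤ L := Real.log_nonneg hp1.le
  rw [hpr]
  have hD : 0 < r ^ 2 + 2 * c * r + 1 := by nlinarith
  have hDle : r ^ 2 + 2 * c * r + 1 ≤ (r + 1) ^ 2 := by nlinarith
  -- common nonnegative numerator `A = 2L(1−c)·r(r−1)`
  have hA : 0 ≤ 2 * L * (1 - c) * (r * (r - 1)) := by
    have : 0 ≤ r * (r - 1) := by nlinarith
    have : 0 ≤ 1 - c := by linarith
    positivity
  rw [show 2 * L * (r * (r - 1)) / (r + 1) ^ 3 * (1 - c) = 2 * L * (1 - c) * (r * (r - 1)) / ((r + 1) * (r + 1) ^ 2) by ring]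
  exact div_le_div_of_nonneg_left hA (by positivity) (mul_le_mul_of_nonneg_left hDle (by linarith))

/-- `1 − cos(π/(m+2)) ≥ 2/(m+2)²` (from `1 − cos x = 2sin²(x/2)` and Jordan's `sin y ≥ (2/π)y` on `[0, π/2]`). -/
theorem one_sub_cos_ge (m : ℕ) : 2 / ((m : ℝ) + 2) ^ 2 ≤ 1 - Real.cos (π / (m + 2)) := by
  have hm : (0 : ℝ) < m + 2 := by positivity
  set y : ℝ := π / (m + 2) / 2 with hy
  have hy0 : 0 ≤ y := by positivity
  have hy1 : y ≤ π / 2 := by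
    rw [hy]
    have : π / (m + 2) ≤ π := div_le_self Real.pi_pos.le (by linarith [(Nat.cast_nonneg m : (0 : ℝ) ≤ m)])
    linarith
  have hcos : 1 - Real.cos (π / (m + 2)) = 2 * Real.sin y ^ 2 := by
    rw [show π / ((m : ℝ) + 2) = 2 * y by rw [hy]; ring, Real.cos_two_mul]
    nlinarith [Real.sin_sq_add_cos_sq y]
  have hj := Real.mul_le_sin hy0 hy1
  have hj0 : 0 ≤ 2 / π * y := by positivity
  have hsq : (2 / π * y) ^ 2 ≤ Real.sin y ^ 2 := pow_le_pow_left₀ hj0 hj 2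
  have hval : (2 / π * y) ^ 2 = 1 / ((m : ℝ) + 2) ^ 2 := by
    rw [hy]; field_simp
  rw [hcos]
  calc 2 / ((m : ℝ) + 2) ^ 2 = 2 * (2 / π * y) ^ 2 := by rw [hval]; ring
    _ ≤ 2 * Real.sin y ^ 2 := by linarith [hsq]

/-- **Saving in `m`:** `F_p − F̂_p(m) ≥ 4·log p·√p(√p − 1)/((√p + 1)³·(m + 2)²)`. -/
theorem allWindow_sub_bandEdge_ge_sq {p : ℕ} (hp : p.Prime) (m : ℕ) :
    4 * Real.log p * (Real.sqrt p * (Real.sqrt p - 1)) / ((Real.sqrt p + 1) ^ 3 * ((m : ℝ) + 2) ^ 2) ≤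
      2 * Real.log p / (Real.sqrt p + 1) -
        2 * Real.log p * (1 + Real.cos (π / (m + 2)) * Real.sqrt p) / (p + 2 * Real.cos (π / (m + 2)) * Real.sqrt p + 1) := by
  refine le_trans ?_ (allWindow_sub_bandEdge_ge hp m)
  have hp1 : (1 : ℝ) < p := by exact_mod_cast hp.one_lt
  have hs1 : 1 < Real.sqrt p := by rw [show (1 : ℝ) = Real.sqrt 1 by simp]; exact Real.sqrt_lt_sqrt zero_le_one hp1
  have hκ : 0 ≤ 2 * Real.log p * (Real.sqrt p * (Real.sqrt p - 1)) / (Real.sqrt p + 1) ^ 3 := by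
    have : 0 ≤ Real.sqrt p * (Real.sqrt p - 1) := by nlinarith
    have : 0 ≤ Real.log p := Real.log_nonneg hp1.le
    positivity
  have h := mul_le_mul_of_nonneg_left (one_sub_cos_ge m) hκ
  have hm : (0 : ℝ) < (m : ℝ) + 2 := by positivity
  calc _ = 2 * Real.log p * (Real.sqrt p * (Real.sqrt p - 1)) / (Real.sqrt p + 1) ^ 3 * (2 / ((m : ℝ) + 2) ^ 2) := by
        field_simp; ring
    _ ≤ _ := h

/-- **The two closed forms agree to third order:** with `F̌_p(m) = 2·log p·(1 + c_m√p − ε_m)/(p + 2c_m√p + 1 − ε_m)`,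
`ε_m = 2sin²(π/(m+2))/(m+2)` (the comb value of `SemilocalDeletionToeplitzBandEdgeCombs`),
`F̂_p(m) − F̌_p(m) = 2·log p·ε_m·(p + c_m√p)/((p + 2c_m√p + 1)(p + 2c_m√p + 1 − ε_m)) ≤ 4π²·log p·(p + √p)/(p(p+1)(m+2)³)` —
the sharp floor `μ_m(p) ∈ [F̌_p(m), F̂_p(m)]` is located to `O(m⁻³)` while `F_p − F̂_p(m) ≍ m⁻²`. -/
theorem bandEdge_sub_bandEdgeComb_le {p : ℕ} (hp : p.Prime) (m : ℕ) :
    2 * Real.log p * (1 + Real.cos (π / (m + 2)) * Real.sqrt p) / (p + 2 * Real.cos (π / (m + 2)) * Real.sqrt p + 1) -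
        2 * Real.log p * (1 + Real.cos (π / (m + 2)) * Real.sqrt p - 2 * Real.sin (π / (m + 2)) ^ 2 / (m + 2)) /
          (p + 2 * Real.cos (π / (m + 2)) * Real.sqrt p + 1 - 2 * Real.sin (π / (m + 2)) ^ 2 / (m + 2)) ≤
      4 * π ^ 2 * Real.log p * (p + Real.sqrt p) / (p * (p + 1) * ((m : ℝ) + 2) ^ 3) := by
  have hp0 : (0 : ℝ) < p := by exact_mod_cast hp.pos
  have hp1 : (1 : ℝ) < p := by exact_mod_cast hp.one_lt
  have hL : 0 ≤ Real.log p := Real.log_nonneg hp1.le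
  have hc0 : 0 ≤ Real.cos (π / (m + 2)) := cos_weight_nonneg m
  have hm : (0 : ℝ) < (m : ℝ) + 2 := by positivity
  set L := Real.log (p : ℝ)
  set c := Real.cos (π / (m + 2))
  set r := Real.sqrt (p : ℝ) with hr
  have hr0 : 0 ≤ r := Real.sqrt_nonneg _
  set ε := 2 * Real.sin (π / (m + 2)) ^ 2 / ((m : ℝ) + 2) with hε
  -- `0 ≤ ε ≤ 2θ²/(m+2) = 2π²/(m+2)³` and `ε ≤ 1`
  have hθ0 : 0 ≤ π / ((m : ℝ) + 2) := by positivity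
  have hsin : Real.sin (π / (m + 2)) ^ 2 ≤ (π / ((m : ℝ) + 2)) ^ 2 := by
    have h1 := Real.sin_le hθ0
    have h2 : 0 ≤ Real.sin (π / ((m : ℝ) + 2)) :=
      Real.sin_nonneg_of_nonneg_of_le_pi hθ0 (div_le_self Real.pi_pos.le (by linarith [(Nat.cast_nonneg m : (0 : ℝ) ≤ m)]))
    exact pow_le_pow_left₀ h2 h1 2
  have hε0 : 0 ≤ ε := by positivity
  have hεb : ε ≤ 2 * π ^ 2 / ((m : ℝ) + 2) ^ 3 := by
    rw [hε, div_le_div_iff₀ hm (by positivity)]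
    have : Real.sin (π / (m + 2)) ^ 2 * ((m : ℝ) + 2) ^ 2 ≤ π ^ 2 := by
      have := mul_le_mul_of_nonneg_right hsin (by positivity : (0 : ℝ) ≤ ((m : ℝ) + 2) ^ 2)
      rwa [div_pow, div_mul_cancel₀ _ (by positivity)] at this
    nlinarith
  have hε1 : ε ≤ 1 := by
    have hs1 : Real.sin (π / (m + 2)) ^ 2 ≤ 1 := Real.sin_sq_le_one _
    rw [hε, div_le_one hm]; linarith [(Nat.cast_nonneg m : (0 : ℝ) ≤ m)]
  have h2c : 0 ≤ 2 * c * r := by positivity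
  have hD : (p : ℝ) + 1 ≤ (p : ℝ) + 2 * c * r + 1 := by linarith
  have hDε : (p : ℝ) ≤ (p : ℝ) + 2 * c * r + 1 - ε := by linarith
  -- exact difference
  have hdiff : 2 * L * (1 + c * r) / (p + 2 * c * r + 1) - 2 * L * (1 + c * r - ε) / (p + 2 * c * r + 1 - ε) =
      2 * L * ε * (p + c * r) / ((p + 2 * c * r + 1) * (p + 2 * c * r + 1 - ε)) := by
    rw [div_sub_div _ _ (by linarith) (by linarith)]
    congr 1; ring
  rw [hdiff, div_le_div_iff₀ (by nlinarith) (by positivity)]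
  -- `2Lε(p + cr)·p(p+1)(m+2)³ ≤ 4π²L(p+r)·D(D−ε)` from `ε(m+2)³ ≤ 2π²`, `p + cr ≤ p + r` (`c ≤ 1`), `p(p+1) ≤ D(D−ε)`... careful: need p(p+1) vs D(D-ε)
  have hc1 : c ≤ 1 := Real.cos_le_one _
  have hcr : (p : ℝ) + c * r ≤ p + r := by nlinarith
  have hεm : ε * ((m : ℝ) + 2) ^ 3 ≤ 2 * π ^ 2 := by
    have := mul_le_mul_of_nonneg_right hεb (by positivity : (0 : ℝ) ≤ ((m : ℝ) + 2) ^ 3)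
    rwa [div_mul_cancel₀ _ (by positivity)] at this
  have hDD : (p : ℝ) * (p + 1) ≤ (p + 2 * c * r + 1) * (p + 2 * c * r + 1 - ε) := by nlinarith
  have hA : 0 ≤ 2 * L * (p + c * r) := by positivity
  calc 2 * L * ε * (p + c * r) * (p * (p + 1) * ((m : ℝ) + 2) ^ 3)
      = (2 * L * (p + c * r)) * (ε * ((m : ℝ) + 2) ^ 3) * (p * (p + 1)) := by ring
    _ ≤ (2 * L * (p + r)) * (2 * π ^ 2) * ((p + 2 * c * r + 1) * (p + 2 * c * r + 1 - ε)) := by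
        gcongr
    _ = 4 * π ^ 2 * L * (p + r) * ((p + 2 * c * r + 1) * (p + 2 * c * r + 1 - ε)) := by ring

/-! ## §2  Window forms (no `m`) -/

variable {P : (ℝ → ℂ) → Prop}

/-- **★ THE BAND-EDGE FLOOR, WINDOW FORM.** For every prime `p ∈ S`, every `c ≥ 0` and every constraint `P`:
`λ_min(S∖{p}; c; P) ≥ λ_min(S; c; P) − 2·log p/(√p + 1) + (log p)³·√p(√p − 1)/((√p + 1)³·(c + log p)²)` —
on a finite window the all-window price `2·log p/(√p+1)` of `SemilocalDeletionToeplitzFloorUniform` is NEVER paid in full; the saving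
decays like `(c + log p)⁻²` (take `m = ⌊2c/log p⌋`, so `2c < (m+1)·log p` and `m + 2 ≤ 2(c + log p)/log p`). -/
theorem semilocalGroundEnergy_erase_ge_window {S : Finset ℕ} {p : ℕ} (hp : p.Prime) (hpS : p ∈ S) {c : ℝ} (hc : 0 ≤ c) :
    semilocalGroundEnergy S P c - 2 * Real.log p / (Real.sqrt p + 1) +
        Real.log p ^ 3 * (Real.sqrt p * (Real.sqrt p - 1)) / ((Real.sqrt p + 1) ^ 3 * (c + Real.log p) ^ 2) ≤
      semilocalGroundEnergy (S.erase p) P c := by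
  have hp1 : (1 : ℝ) < p := by exact_mod_cast hp.one_lt
  have hL : 0 < Real.log p := Real.log_pos hp1
  have hs1 : 1 < Real.sqrt p := by rw [show (1 : ℝ) = Real.sqrt 1 by simp]; exact Real.sqrt_lt_sqrt zero_le_one hp1
  set m : ℕ := ⌊2 * c / Real.log p⌋₊ with hmdef
  have hmle : (m : ℝ) ≤ 2 * c / Real.log p := Nat.floor_le (by positivity)
  have hmlt : 2 * c / Real.log p < m + 1 := Nat.lt_floor_add_one _
  have hm : 2 * c < (m + 1) * Real.log p := by rwa [div_lt_iff₀ hL] at hmlt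
  have hfloor := semilocalGroundEnergy_erase_ge_bandEdge (P := P) hp hpS hm
  have hsave := allWindow_sub_bandEdge_ge_sq hp m
  -- `(m+2)·log p ≤ 2(c + log p)` turns the `(m+2)⁻²` saving into a `(c + log p)⁻²` saving
  have hm2 : ((m : ℝ) + 2) * Real.log p ≤ 2 * (c + Real.log p) := by
    have := (le_div_iff₀ hL).1 hmle
    linarith
  have hK : 0 ≤ Real.log p ^ 3 * (Real.sqrt p * (Real.sqrt p - 1)) / (Real.sqrt p + 1) ^ 3 := by
    have : 0 ≤ Real.sqrt p * (Real.sqrt p - 1) := by nlinarith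
    positivity
  have hmono : Real.log p ^ 3 * (Real.sqrt p * (Real.sqrt p - 1)) / ((Real.sqrt p + 1) ^ 3 * (c + Real.log p) ^ 2) ≤
      4 * Real.log p * (Real.sqrt p * (Real.sqrt p - 1)) / ((Real.sqrt p + 1) ^ 3 * ((m : ℝ) + 2) ^ 2) := by
    have hm0 : (0 : ℝ) < (m : ℝ) + 2 := by positivity
    have hcL : 0 < c + Real.log p := by linarith
    rw [show Real.log p ^ 3 * (Real.sqrt p * (Real.sqrt p - 1)) / ((Real.sqrt p + 1) ^ 3 * (c + Real.log p) ^ 2) =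
        Real.log p ^ 3 * (Real.sqrt p * (Real.sqrt p - 1)) / (Real.sqrt p + 1) ^ 3 * (1 / (c + Real.log p) ^ 2) by
          field_simp,
      show 4 * Real.log p * (Real.sqrt p * (Real.sqrt p - 1)) / ((Real.sqrt p + 1) ^ 3 * ((m : ℝ) + 2) ^ 2) =
        Real.log p ^ 3 * (Real.sqrt p * (Real.sqrt p - 1)) / (Real.sqrt p + 1) ^ 3 *
          (4 / (((m : ℝ) + 2) ^ 2 * Real.log p ^ 2)) by
          field_simp]
    refine mul_le_mul_of_nonneg_left ?_ hK
    rw [div_le_div_iff₀ (by positivity) (by positivity)]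
    nlinarith [mul_pos hm0 hL, hm2]
  linarith

/-- **Deleting a set of primes, window form:** for finite `S`, a finite set `T` of primes, every `c ≥ 0` and every `P`:
`λ_min(S∖T; c; P) ≥ λ_min(S; c; P) − Σ_{p∈T} [2·log p/(√p + 1) − (log p)³√p(√p − 1)/((√p + 1)³(c + log p)²)]` — the joint floor of any
prime deletion stays below the additive all-window limit `Σ_p F_p` by at least `Σ_p K_p/(c + log p)²`. -/
theorem semilocalGroundEnergy_sdiff_ge_window {S T : Finset ℕ} (hT : ∀ p ∈ T, p.Prime) {c : ℝ} (hc : 0 ≤ c) :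
    semilocalGroundEnergy S P c - ∑ p ∈ T, (2 * Real.log p / (Real.sqrt p + 1) -
        Real.log p ^ 3 * (Real.sqrt p * (Real.sqrt p - 1)) / ((Real.sqrt p + 1) ^ 3 * (c + Real.log p) ^ 2)) ≤
      semilocalGroundEnergy (S \ T) P c := by
  induction T using Finset.induction_on with
  | empty => simp
  | @insert a T haT ih =>
    have ih' := ih fun p hp ↦ hT p (Finset.mem_insert_of_mem hp)
    have ha : a.Prime := hT a (Finset.mem_insert_self a T)
    rw [Finset.sum_insert haT, Finset.sdiff_insert]
    have hp1 : (1 : ℝ) < a := by exact_mod_cast ha.one_lt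
    have hs1 : 1 < Real.sqrt a := by rw [show (1 : ℝ) = Real.sqrt 1 by simp]; exact Real.sqrt_lt_sqrt zero_le_one hp1
    have hL : 0 < Real.log a := Real.log_pos hp1
    -- the bracket is nonnegative (it is at most the cost, which is at most `F_a`): `K_a/(c+L)² ≤ L·r(r−1)/(r+1)³ ≤ 2L/(r+1)`
    have hcost : 0 ≤ 2 * Real.log a / (Real.sqrt a + 1) -
        Real.log a ^ 3 * (Real.sqrt a * (Real.sqrt a - 1)) / ((Real.sqrt a + 1) ^ 3 * (c + Real.log a) ^ 2) := by
      set r := Real.sqrt (a : ℝ)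
      set L := Real.log (a : ℝ)
      have h1 : L ^ 3 * (r * (r - 1)) / ((r + 1) ^ 3 * (c + L) ^ 2) ≤ L * (r * (r - 1)) / (r + 1) ^ 3 := by
        rw [div_le_div_iff₀ (by positivity) (by positivity)]
        have : 0 ≤ L * (r * (r - 1)) * (r + 1) ^ 3 := by
          have : 0 ≤ r * (r - 1) := by nlinarith
          positivity
        have hcL : L ^ 2 ≤ (c + L) ^ 2 := by nlinarith
        nlinarith
      have h2 : L * (r * (r - 1)) / (r + 1) ^ 3 ≤ 2 * L / (r + 1) := by
        rw [div_le_div_iff₀ (by positivity) (by positivity)]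
        nlinarith [mul_pos hL (by positivity : (0 : ℝ) < (r + 1) ^ 2)]
      linarith
    by_cases haS : a ∈ S \ T
    · have := semilocalGroundEnergy_erase_ge_window (P := P) ha haS hc
      linarith
    · rw [Finset.erase_eq_of_notMem haS]
      linarith

end Summit.RiemannHypothesis.RiemannHypothesis.Theorems.SemilocalDeletionToeplitzBandEdgeDeficit

end
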